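import Summits.QuantumFields.YangMills.Theorems.BalabanUVNodesN11Sect3SupplySplice
import Literature.MathematicalPhysics.QuantumFieldTheory.Balaban1983to89.B14SeparationOfRecord

/-!
# DAG node N11 — [III] §3's SUPPLY OWED ONLY AT THE 𝐓-PRESENT EXPANSION CHILDREN, i.e. AT THE LABELLED LARGE-FIELD DECOMPOSITIONS `σ(s₀, t)` OF PRINT's (3.5)∕(3.20):
# the minimal supply of `…Sect3SupplySpliceDefs` with its guard sharpened from «parent present» to «child's 𝐓-slot present», and read through the index map of record

Cell `pub-ymgap`, YM-PLAN Track A (HUMAN RULING D-0062 ∕ D-0149), seat `pub-ymgap-dag-n11-e` (g15; R134 fan-out row N11∕s3), route `BalabanUVNodes` rev 25 (v1.7 `CoPH` key), item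
K1⁷ `StabilityBAtRecordR13SepCoPH` = stmt-QuantumFields-20542 (helper lane, count-neutral).  [III] = [Balaban1988Convergent], [IV] = [Balaban1989LargeFieldI].  Over this seat's
`…Sect3SupplySplice` (p586169: `sect3SupplyAt_of_spliceSupply`, `lawsT_child_graftAbove_of_rows`, `lawsT_child_absent_of_newEClauses`), `…Sect3SupplySpliceDefs ∕ …Frame` (p585501 ∕
p585728) and `…B14SeparationOfRecord` (this seat, g6: `exists_label_of_slotsTOfRecord_succ_ne_zero` — a present 𝐓-slot is produced by the index map `σOfRecord`).

WHY THIS FILE.  `Sect3SpliceSupplyAt θ p k` asks (O1)∕(O2)∕(O3) at every expansion child `s′` whose PARENT is present (`ρ_k(init s′) ≢ 0`).  The splice of p586169 actually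
needs them only where the CHILD's 𝐓-slot is present (`𝐓ρ_k(s′) ≢ 0`): at a 𝐓-absent child the clause holds by its zero disjunct and the laws are served by the absent-branch
witness (old `𝐁^{(k)}` and new `𝐑 ∕ 𝐁` zeroed, new 𝐄 transferred) — exactly as at the children of absent parents.  And by `…B14SeparationOfRecord` a 𝐓-present child IS a
labelled child `σ(init s′, t)` of the index map of record (print's (3.5)∕(3.20): the new large-field decomposition `(P, Q, R, S)_{k+1}` determines `Ω_{k+1}, Λ_{k+1}`; off the
range of `σ` the step weight is an empty sum).  HENCE the supply reads, per history `s₀` of length `k` with its exposed witness and per LABEL `t` of the `(k+1)`-st step: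
IF `σ(s₀, t)` expands and its 𝐓-slot is present THEN (O1)∕(O2)∕(O3) at `σ(s₀, t)` — print's own indexing of §3.
§1 ★ `sect3SupplyAt_of_spliceSupply_of_guard` — the splice of p586169 for an ARBITRARY guard `G` on the children with `¬ G s′ ⇒ 𝐓ρ_k(s′) ≡ 0` (master form; p586169's
   theorem is the instance `G s′ := ρ_k(init s′) ≢ 0` by p580585).
§2 ★★ `sect3SupplyAt_of_spliceSupply_at_present_children` — guard `G s′ := 𝐓ρ_k(s′) ≢ 0` (the weakest guard: nothing owed where the 𝐓-slot vanishes; the parent-keyed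
   `Sect3SpliceSupplyAt` implies this form since a 𝐓-present child has a present parent, p580585 — p586169's theorem is the parent-keyed instance of §1).
§3 ★★★ `sect3SupplyAt_of_spliceSupply_at_labels` — the same keyed on the LABELS: obligations at `σOfRecord … k s₀ t` for every `s₀` and `t`, old witness `t s₀` (`init (σ s₀ t) = s₀`).
§4 A6: `sect3SpliceSupplyAt_of_forall_not_present` — where no expansion child has a present parent the minimal supply is inhabited by nothing (`tnew := 0`).

HONEST FRAMING.  Count-neutral kernel bookkeeping; the obligations (O1)∕(O2)∕(O3) ([III] Sect. 1 ∕ §3 ∕ Thm 2 at the objects of record + LOCATED-SPACEB's (O1)) are DISPLAYED,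
not proved; the 𝐓-image IDENTITY is cited as (3.25) p.270 + §3 p.279 «𝐓ρ_k represented exactly in the form … with k+1 instead of k» (ref-B g25 NIT-L2 on p585501: NOT
(3.67), which is the `t_π`-differentiated 𝐄-bound feeding (2.43)); nothing of Bałaban asserted; N11 NOT discharged; K1⁷ NOT closed; counts unmoved (typed 28∕28 · discharged
5∕27).  One finite `𝕋⁴_{L^K}` programme at fixed `ε = L^{−K}`; NOT ℝ⁴, NOT OS, NOT a mass gap, NOT Clay.
Sources: [III] Theorem p.245, Thm 1 p.262, Thm 2 p.263, §2 p.262, (3.1)–(3.5) pp.264–265, (3.20) p.269, (3.24)–(3.25) p.270, §3 p.279, (2.23)–(2.31) pp.258–260, (2.34)–(2.42)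
p.261; [IV] (0.2)–(0.4) p.176.
-/

noncomputable section

open MeasureTheory
open scoped BigOperators Matrix.Norms.L2Operator

namespace Summit.QuantumFields.YangMills.Theorems.BalabanUVNodesN11Sect3SupplySpliceLabels

open Literature.MathematicalPhysics.QuantumFieldTheory.Balaban1983to89 T4Continuum Node00 Node00.Tk DagBinding
open Step B14.Eq227LocalizedTerms
open Literature.MathematicalPhysics.QuantumFieldTheory.Balaban1983to89.B14SeparationOfRecord (exists_label_of_slotsTOfRecord_succ_ne_zero)
open BalabanUVNodesN11Sect3SupplyDefs (Sect3SupplyAt)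
open BalabanUVNodesN11Sect3SupplySpliceDefs
open BalabanUVNodesN11Sect3SupplySpliceFrame
open BalabanUVNodesN11Sect3SupplySplice (lawsT_child_graftAbove_of_rows lawsT_child_absent_of_newEClauses)
open BalabanUVNodesN11NoExpansionStepReductionRePinnedUnivECoPH (newEClauses_of_lawsT_of_eqE)

variable {F : T4Family} {N : ℕ} [NeZero N]
variable (θ : Stage13HParams F N) (p : B12.RunParams)

/-! ## §1. Master form: the splice for an arbitrary guard on the children -/

section Guard

/-- **★ THE SPLICE FOR AN ARBITRARY GUARD ON THE CHILDREN** (master form of p586169's `sect3SupplyAt_of_spliceSupply`): let `G` be any predicate on the histories of length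
`k+1` such that OFF `G` the 𝐓-slot vanishes (`¬ G s′ ⇒ 𝐓ρ_k(s′) ≡ 0`).  If for every exposed witness `(t, E_k)` the supplier gives `tnew` (universal in 𝐄) and `EkN` with
(O1)∕(O2)∕(O3) at every expansion child `s′` WITH `G s′`, then `Sect3SupplyAt θ p k`.  Construction as in p586169 with «present parent» replaced by `G`: no-expansion
histories `graftAbove k (t ∘ init) (zeroRB tnew)`; `G`-children `graftAbove k (t ∘ init) tnew` (laws by `lawsT_child_graftAbove_of_rows`, clause (O3)); the other expansion
children `graftAbove k (dropBFrom k (t ∘ init)) (zeroRB tnew)` (laws by `lawsT_child_absent_of_newEClauses`, new-𝐄 clauses transferred from a `G`-child or, if there is none,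
the whole family with `𝐄^{(k+1)} := 0`; clause by the zero disjunct from `hG`).  `0 ≤ E₀, B₀` for the zeroed terms.
[cite: Balaban1988Convergent, Theorem p.245, §2 p.262, §3 p.279, (3.24)–(3.25) p.270, (3.1) p.264, (2.25)–(2.28) p.259, (2.40)–(2.42) p.261, (2.17)–(2.18) p.257] -/
theorem sect3SupplyAt_of_spliceSupply_of_guard {k : ℕ} (hE₀ : 0 ≤ θ.s2.lf.E₀) (hB₀ : 0 ≤ θ.s2.lf.B₀)
    (G : SeqOfRecord F θ.ν θ.τ9.M (gOfRecord₁₃ F N θ.toStage13Params p) p.K (k + 1) → Prop)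
    (hG : ∀ s : SeqOfRecord F θ.ν θ.τ9.M (gOfRecord₁₃ F N θ.toStage13Params p) p.K (k + 1), ¬ G s → slotsTOfRecord F N θ.ν θ.τ9 (EOfRecord₁₃ F N θ.toStage13Params) (wOfRecord₉ F N θ.toStage9Params) θ.ppSel p (gOfRecord₁₃ F N θ.toStage13Params p) (k + 1) s = 0)
    (h :
        ∀ (t : SeqOfRecord F θ.ν θ.τ9.M (gOfRecord₁₃ F N θ.toStage13Params p) p.K k → Sect2.TermValues (F.P p.K) (MatA N) (FluctV N) θ.τ9.M) (Ek : SeqOfRecord F θ.ν θ.τ9.M (gOfRecord₁₃ F N θ.toStage13Params p) p.K k → ℝ),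
          HasSect2FormAtZS F N (FluctV N) p.K (settingOfRecord₁₃ F N θ.toStage13Params p) k (θ.rzAt p) (WtOfRecord₁₃H F N θ p) (UbgOfRecord₁₃CoP F N θ.toStage13Params p k)
            (fun s u => Sect2.LawsRT (sect2TowerOfRecord F N (FluctV N) p.K (settingOfRecord₁₃ F N θ.toStage13Params p) (θ.rzAt p s) s u) (settingOfRecord₁₃ F N θ.toStage13Params p).lf k)
            (slotsOfRecord F N θ.ν θ.τ9 (EOfRecord₁₃ F N θ.toStage13Params) (wOfRecord₉ F N θ.toStage9Params) θ.ppSel p (gOfRecord₁₃ F N θ.toStage13Params p) k) t Ek →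
          ∃ (tnew : SeqOfRecord F θ.ν θ.τ9.M (gOfRecord₁₃ F N θ.toStage13Params p) p.K (k + 1) → Sect2.TermValues (F.P p.K) (MatA N) (FluctV N) θ.τ9.M) (EkN : SeqOfRecord F θ.ν θ.τ9.M (gOfRecord₁₃ F N θ.toStage13Params p) p.K (k + 1) → ℝ),
            Sect2.UniversalE tnew ∧
            ∀ s : SeqOfRecord F θ.ν θ.τ9.M (gOfRecord₁₃ F N θ.toStage13Params p) p.K (k + 1), s.Ω (k + 1) ≠ ∅ →
              G s →
              -- (O1) the old boundary term `𝐁^{(k)}` on the CHILD's space `Ũ^c_k(X)`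
              (1 ≤ k →
                (∀ (X : (Sect2.domSys (F.P p.K) θ.τ9.M k).Dom) (φ : Sect2.CPair (F.P p.K) (MatA N)) (a : SFluct (F.P p.K) (FluctV N)),
                  φ ∈ (sect2TowerOfRecord F N (FluctV N) p.K (settingOfRecord₁₃ F N θ.toStage13Params p) (θ.rzAt p s) s (t s.init)).spaceB k X →
                    ‖(t s.init).B k X φ a‖ ≤ (settingOfRecord₁₃ F N θ.toStage13Params p).lf.B₀ * Real.exp (-(settingOfRecord₁₃ F N θ.toStage13Params p).lf.κ * (Sect2.domSys (F.P p.K) θ.τ9.M k).dj X)) ∧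
                (∀ (X : (Sect2.domSys (F.P p.K) θ.τ9.M k).Dom) (a : SFluct (F.P p.K) (FluctV N)),
                  AnalyticOnNhd ℂ (fun φ => (t s.init).B k X φ a)
                    ((sect2TowerOfRecord F N (FluctV N) p.K (settingOfRecord₁₃ F N θ.toStage13Params p) (θ.rzAt p s) s (t s.init)).spaceB k X))) ∧
              -- (O2) the new terms: r11's new-term obligations and analyticity at `k+1`
              Step.LFNewTerms (sect2TowerOfRecord F N (FluctV N) p.K (settingOfRecord₁₃ F N θ.toStage13Params p) (θ.rzAt p s) s (tnew s))
                (settingOfRecord₁₃ F N θ.toStage13Params p).lf (settingOfRecord₁₃ F N θ.toStage13Params p).βc k ∧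
              (∀ (X : (Sect2.domSys (F.P p.K) θ.τ9.M (k + 1)).Dom) (z : Site (F.P p.K) (k + 1)) (g : ℝ), 0 ≤ g → g ≤ (settingOfRecord₁₃ F N θ.toStage13Params p).lf.γ →
                AnalyticOnNhd ℂ ((tnew s).E (k + 1) X z g)
                  ((sect2TowerOfRecord F N (FluctV N) p.K (settingOfRecord₁₃ F N θ.toStage13Params p) (θ.rzAt p s) s (tnew s)).space (k + 1) X
                    ((settingOfRecord₁₃ F N θ.toStage13Params p).lf.alpha0 ((settingOfRecord₁₃ F N θ.toStage13Params p).flow.g (k + 1)))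
                    ((settingOfRecord₁₃ F N θ.toStage13Params p).lf.alpha1 ((settingOfRecord₁₃ F N θ.toStage13Params p).flow.g (k + 1))))) ∧
              (∀ X : (Sect2.domSys (F.P p.K) θ.τ9.M (k + 1)).Dom,
                AnalyticOnNhd ℂ ((tnew s).R (k + 1) X)
                  ((sect2TowerOfRecord F N (FluctV N) p.K (settingOfRecord₁₃ F N θ.toStage13Params p) (θ.rzAt p s) s (tnew s)).space (k + 1) X
                    ((settingOfRecord₁₃ F N θ.toStage13Params p).lf.alpha0 ((settingOfRecord₁₃ F N θ.toStage13Params p).flow.g (k + 1)))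
                    ((settingOfRecord₁₃ F N θ.toStage13Params p).lf.alpha1 ((settingOfRecord₁₃ F N θ.toStage13Params p).flow.g (k + 1))))) ∧
              (∀ (X : (Sect2.domSys (F.P p.K) θ.τ9.M (k + 1)).Dom) (a : SFluct (F.P p.K) (FluctV N)),
                AnalyticOnNhd ℂ (fun φ => (tnew s).B (k + 1) X φ a)
                  ((sect2TowerOfRecord F N (FluctV N) p.K (settingOfRecord₁₃ F N θ.toStage13Params p) (θ.rzAt p s) s (tnew s)).spaceB (k + 1) X)) ∧
              -- (O3) the 𝐓-image clause for the spliced witness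
              (slotsTOfRecord F N θ.ν θ.τ9 (EOfRecord₁₃ F N θ.toStage13Params) (wOfRecord₉ F N θ.toStage9Params) θ.ppSel p
                  (gOfRecord₁₃ F N θ.toStage13Params p) (k + 1) s = 0 ∨
                ∀ᵐ V' ∂fieldMeasure (F.P p.K) (k + 1) (SU N),
                  chiSeqOfRecord F N θ.ν θ.τ9.M (gOfRecord₁₃ F N θ.toStage13Params p) p.K (k + 1) s V' ≠ 0 →
                    slotsTOfRecord F N θ.ν θ.τ9 (EOfRecord₁₃ F N θ.toStage13Params) (wOfRecord₉ F N θ.toStage9Params) θ.ppSel p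
                        (gOfRecord₁₃ F N θ.toStage13Params p) (k + 1) s V' =
                      sect2Slot F N (FluctV N) p.K (settingOfRecord₁₃ F N θ.toStage13Params p) (θ.rzAt p s) (WtOfRecord₁₃H F N θ p s) s
                        (graftAbove k (t s.init) (tnew s)) (EkN s) (UbgOfRecord₁₃CoP F N θ.toStage13Params p (k + 1) s) V')) :
    Sect3SupplyAt θ p k := by
  classical
  intro t Ek hS
  obtain ⟨hu, hs⟩ := hS
  obtain ⟨tnew, EkN, huN, hx⟩ := h t Ek ⟨hu, hs⟩
  -- the no-expansion bookkeeping of `graftAbove k (t ∘ init) (zeroRB v)` for any new source `v`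
  have hbook : ∀ (s : SeqOfRecord F θ.ν θ.τ9.M (gOfRecord₁₃ F N θ.toStage13Params p) p.K (k + 1)) (v : Sect2.TermValues (F.P p.K) (MatA N) (FluctV N) θ.τ9.M),
      (∀ j, j ≤ k → ∀ X z g φ, (graftAbove k (t s.init) (zeroRB v)).E j X z g φ = (t s.init).E j X z g φ) ∧
      (∀ j, j ≤ k → ∀ X φ, (graftAbove k (t s.init) (zeroRB v)).R j X φ = (t s.init).R j X φ) ∧
      (∀ j, j ≤ k → ∀ X φ a, (graftAbove k (t s.init) (zeroRB v)).B j X φ a = (t s.init).B j X φ a) ∧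
      (∀ X φ, (graftAbove k (t s.init) (zeroRB v)).R (k + 1) X φ = 0) ∧ (∀ X φ a, (graftAbove k (t s.init) (zeroRB v)).B (k + 1) X φ a = 0) := fun s v =>
    ⟨fun j hj X z g φ => graftAbove_E_of_le _ _ hj X z g φ, fun j hj X φ => graftAbove_R_of_le _ _ hj X φ, fun j hj X φ a => graftAbove_B_of_le _ _ hj X φ a,
      fun X φ => by rw [graftAbove_R_of_lt _ _ (Nat.lt_succ_self k)]; rfl, fun X φ a => by rw [graftAbove_B_of_lt _ _ (Nat.lt_succ_self k)]; rfl⟩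
  by_cases hex : ∃ s₁ : SeqOfRecord F θ.ν θ.τ9.M (gOfRecord₁₃ F N θ.toStage13Params p) p.K (k + 1), s₁.Ω (k + 1) ≠ ∅ ∧ G s₁
  · -- SOME expansion child satisfies the guard: the new 𝐄 is the supplier's
    obtain ⟨s₁, hs₁Ω, hs₁ρ⟩ := hex
    have hLpres : ∀ s : SeqOfRecord F θ.ν θ.τ9.M (gOfRecord₁₃ F N θ.toStage13Params p) p.K (k + 1), s.Ω (k + 1) ≠ ∅ → G s →
        Sect2.LawsT (sect2TowerOfRecord F N (FluctV N) p.K (settingOfRecord₁₃ F N θ.toStage13Params p) (θ.rzAt p s) s (graftAbove k (t s.init) (tnew s)))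
          (settingOfRecord₁₃ F N θ.toStage13Params p).lf (settingOfRecord₁₃ F N θ.toStage13Params p).βc k := fun s hsΩ hsρ =>
      lawsT_child_graftAbove_of_rows θ p s (hs s.init).1 (hx s hsΩ hsρ).1 (hx s hsΩ hsρ).2.1 (hx s hsΩ hsρ).2.2.1 (hx s hsΩ hsρ).2.2.2.1 (hx s hsΩ hsρ).2.2.2.2.1
    obtain ⟨tT, htT⟩ : ∃ tT : SeqOfRecord F θ.ν θ.τ9.M (gOfRecord₁₃ F N θ.toStage13Params p) p.K (k + 1) → Sect2.TermValues (F.P p.K) (MatA N) (FluctV N) θ.τ9.M,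
        ∀ s, tT s = if s.Ω (k + 1) = ∅ then graftAbove k (t s.init) (zeroRB (tnew s)) else
          if G s then graftAbove k (t s.init) (tnew s) else graftAbove k (dropBFrom k (t s.init)) (zeroRB (tnew s)) := ⟨_, fun _ => rfl⟩
    obtain ⟨EkT, hEkT⟩ : ∃ EkT : SeqOfRecord F θ.ν θ.τ9.M (gOfRecord₁₃ F N θ.toStage13Params p) p.K (k + 1) → ℝ, ∀ s, EkT s = if s.Ω (k + 1) = ∅ then Ek s.init else EkN s := ⟨_, fun _ => rfl⟩
    have hTE : ∀ s, (tT s).E = (graftAbove k (t s.init) (tnew s)).E := fun s => by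
      rw [htT s]; split_ifs <;> rfl
    refine ⟨tT, EkT, universalE_graftAbove hu huN k (fun s => s.init) tT hTE, fun s hΩ => ?_, fun s hsΩ => ?_⟩
    · rw [htT s, if_pos hΩ]
      obtain ⟨h1, h2, h3, h4, h5⟩ := hbook s (tnew s)
      exact ⟨h1, h2, h3, h4, h5, by rw [hEkT s, if_pos hΩ]⟩
    · by_cases hsρ : G s
      · -- guarded child: (O1) ∕ (O2) give the laws, (O3) the clause
        rw [htT s, if_neg hsΩ, if_pos hsρ]
        refine ⟨hLpres s hsΩ hsρ, ?_⟩
        rw [hEkT s, if_neg hsΩ]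
        exact (hx s hsΩ hsρ).2.2.2.2.2
      · -- unguarded child: new 𝐄 transferred from `s₁`, everything else zero above `k` (and `𝐁^{(k)}`), clause by the zero disjunct
        rw [htT s, if_neg hsΩ, if_neg hsρ]
        refine ⟨lawsT_child_absent_of_newEClauses θ p hB₀ s (hs s.init).1 ?_, Or.inl (hG s hsρ)⟩
        have hEE : (graftAbove k (dropBFrom k (t s.init)) (zeroRB (tnew s))).E = (graftAbove k (t s₁.init) (tnew s₁)).E := by
          rw [graftAbove_E, graftAbove_E]
          funext j X z g φ
          show (if j ≤ k then (t s.init).E j X z g φ else (tnew s).E j X z g φ) = if j ≤ k then (t s₁.init).E j X z g φ else (tnew s₁).E j X z g φ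
          rw [hu s.init s₁.init, huN s s₁]
        exact newEClauses_of_lawsT_of_eqE (settingOfRecord₁₃ F N θ.toStage13Params p) (Rz := θ.rzAt p s₁) (Rz' := θ.rzAt p s) rfl s₁.Ω s.Ω hEE (hLpres s₁ hs₁Ω hs₁ρ)
  · -- NO expansion child satisfies the guard: run with `𝐄^{(k+1)} := 0`
    have habs : ∀ s : SeqOfRecord F θ.ν θ.τ9.M (gOfRecord₁₃ F N θ.toStage13Params p) p.K (k + 1), s.Ω (k + 1) ≠ ∅ → ¬ G s := fun s hsΩ hG' => hex ⟨s, hsΩ, hG'⟩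
    obtain ⟨tT, htT⟩ : ∃ tT : SeqOfRecord F θ.ν θ.τ9.M (gOfRecord₁₃ F N θ.toStage13Params p) p.K (k + 1) → Sect2.TermValues (F.P p.K) (MatA N) (FluctV N) θ.τ9.M,
        ∀ s, tT s = if s.Ω (k + 1) = ∅ then graftAbove k (t s.init) (zeroRB Sect2.TermValues.zero) else
          graftAbove k (dropBFrom k (t s.init)) (zeroRB Sect2.TermValues.zero) := ⟨_, fun _ => rfl⟩
    have hTE : ∀ s, (tT s).E = (graftAbove k (t s.init) ((fun _ => (Sect2.TermValues.zero : Sect2.TermValues (F.P p.K) (MatA N) (FluctV N) θ.τ9.M)) s)).E := fun s => by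
      rw [htT s]; split_ifs <;> rfl
    refine ⟨tT, fun s => Ek s.init, universalE_graftAbove hu (Sect2.universalE_const _) k (fun s => s.init) tT hTE, fun s hΩ => ?_, fun s hsΩ => ?_⟩
    · rw [htT s, if_pos hΩ]
      obtain ⟨h1, h2, h3, h4, h5⟩ := hbook s Sect2.TermValues.zero
      exact ⟨h1, h2, h3, h4, h5, rfl⟩
    · rw [htT s, if_neg hsΩ]
      refine ⟨lawsT_child_absent_of_newEClauses θ p hB₀ s (hs s.init).1 ?_, Or.inl (hG s (habs s hsΩ))⟩
      exact newEClauses_of_zeroE (settingOfRecord₁₃ F N θ.toStage13Params p) (θ.rzAt p s) s.Ω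
        (fun X z g φ => by rw [graftAbove_E_of_lt _ _ (Nat.lt_succ_self k)]; rfl) hE₀

end Guard

/-! ## §2. The weakest guard: nothing is owed where the child's 𝐓-slot vanishes -/

section Present

/-- **★★ `Sect3SupplyAt θ p k` FROM THE MINIMAL SUPPLY AT THE 𝐓-PRESENT EXPANSION CHILDREN ONLY**: (O1)∕(O2)∕(O3) owed at the expansion children `s′` with
`𝐓ρ_k(s′) ≢ 0` (def-T's `slotsTOfRecord … (k+1) s′ ≠ 0`) — the weakest guard; it contains «parent present» (p580585: an absent parent has an absent child) and «`s′` is a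
labelled decomposition `σ(init s′, t)` with non-zero step weight» (§3).  §1 with `G s′ := 𝐓ρ_k(s′) ≢ 0`.
[cite: Balaban1988Convergent, Theorem p.245, §3 p.279, (3.24)–(3.25) p.270, (3.1)–(3.5) pp.264–265, (3.20) p.269] -/
theorem sect3SupplyAt_of_spliceSupply_at_present_children {k : ℕ} (hE₀ : 0 ≤ θ.s2.lf.E₀) (hB₀ : 0 ≤ θ.s2.lf.B₀)
    (h :
        ∀ (t : SeqOfRecord F θ.ν θ.τ9.M (gOfRecord₁₃ F N θ.toStage13Params p) p.K k → Sect2.TermValues (F.P p.K) (MatA N) (FluctV N) θ.τ9.M) (Ek : SeqOfRecord F θ.ν θ.τ9.M (gOfRecord₁₃ F N θ.toStage13Params p) p.K k → ℝ),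
          HasSect2FormAtZS F N (FluctV N) p.K (settingOfRecord₁₃ F N θ.toStage13Params p) k (θ.rzAt p) (WtOfRecord₁₃H F N θ p) (UbgOfRecord₁₃CoP F N θ.toStage13Params p k)
            (fun s u => Sect2.LawsRT (sect2TowerOfRecord F N (FluctV N) p.K (settingOfRecord₁₃ F N θ.toStage13Params p) (θ.rzAt p s) s u) (settingOfRecord₁₃ F N θ.toStage13Params p).lf k)
            (slotsOfRecord F N θ.ν θ.τ9 (EOfRecord₁₃ F N θ.toStage13Params) (wOfRecord₉ F N θ.toStage9Params) θ.ppSel p (gOfRecord₁₃ F N θ.toStage13Params p) k) t Ek →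
          ∃ (tnew : SeqOfRecord F θ.ν θ.τ9.M (gOfRecord₁₃ F N θ.toStage13Params p) p.K (k + 1) → Sect2.TermValues (F.P p.K) (MatA N) (FluctV N) θ.τ9.M) (EkN : SeqOfRecord F θ.ν θ.τ9.M (gOfRecord₁₃ F N θ.toStage13Params p) p.K (k + 1) → ℝ),
            Sect2.UniversalE tnew ∧
            ∀ s : SeqOfRecord F θ.ν θ.τ9.M (gOfRecord₁₃ F N θ.toStage13Params p) p.K (k + 1), s.Ω (k + 1) ≠ ∅ →
              slotsTOfRecord F N θ.ν θ.τ9 (EOfRecord₁₃ F N θ.toStage13Params) (wOfRecord₉ F N θ.toStage9Params) θ.ppSel p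
                  (gOfRecord₁₃ F N θ.toStage13Params p) (k + 1) s ≠ 0 →
              -- (O1) the old boundary term `𝐁^{(k)}` on the CHILD's space `Ũ^c_k(X)`
              (1 ≤ k →
                (∀ (X : (Sect2.domSys (F.P p.K) θ.τ9.M k).Dom) (φ : Sect2.CPair (F.P p.K) (MatA N)) (a : SFluct (F.P p.K) (FluctV N)),
                  φ ∈ (sect2TowerOfRecord F N (FluctV N) p.K (settingOfRecord₁₃ F N θ.toStage13Params p) (θ.rzAt p s) s (t s.init)).spaceB k X →
                    ‖(t s.init).B k X φ a‖ ≤ (settingOfRecord₁₃ F N θ.toStage13Params p).lf.B₀ * Real.exp (-(settingOfRecord₁₃ F N θ.toStage13Params p).lf.κ * (Sect2.domSys (F.P p.K) θ.τ9.M k).dj X)) ∧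
                (∀ (X : (Sect2.domSys (F.P p.K) θ.τ9.M k).Dom) (a : SFluct (F.P p.K) (FluctV N)),
                  AnalyticOnNhd ℂ (fun φ => (t s.init).B k X φ a)
                    ((sect2TowerOfRecord F N (FluctV N) p.K (settingOfRecord₁₃ F N θ.toStage13Params p) (θ.rzAt p s) s (t s.init)).spaceB k X))) ∧
              -- (O2) the new terms: r11's new-term obligations and analyticity at `k+1`
              Step.LFNewTerms (sect2TowerOfRecord F N (FluctV N) p.K (settingOfRecord₁₃ F N θ.toStage13Params p) (θ.rzAt p s) s (tnew s))
                (settingOfRecord₁₃ F N θ.toStage13Params p).lf (settingOfRecord₁₃ F N θ.toStage13Params p).βc k ∧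
              (∀ (X : (Sect2.domSys (F.P p.K) θ.τ9.M (k + 1)).Dom) (z : Site (F.P p.K) (k + 1)) (g : ℝ), 0 ≤ g → g ≤ (settingOfRecord₁₃ F N θ.toStage13Params p).lf.γ →
                AnalyticOnNhd ℂ ((tnew s).E (k + 1) X z g)
                  ((sect2TowerOfRecord F N (FluctV N) p.K (settingOfRecord₁₃ F N θ.toStage13Params p) (θ.rzAt p s) s (tnew s)).space (k + 1) X
                    ((settingOfRecord₁₃ F N θ.toStage13Params p).lf.alpha0 ((settingOfRecord₁₃ F N θ.toStage13Params p).flow.g (k + 1)))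
                    ((settingOfRecord₁₃ F N θ.toStage13Params p).lf.alpha1 ((settingOfRecord₁₃ F N θ.toStage13Params p).flow.g (k + 1))))) ∧
              (∀ X : (Sect2.domSys (F.P p.K) θ.τ9.M (k + 1)).Dom,
                AnalyticOnNhd ℂ ((tnew s).R (k + 1) X)
                  ((sect2TowerOfRecord F N (FluctV N) p.K (settingOfRecord₁₃ F N θ.toStage13Params p) (θ.rzAt p s) s (tnew s)).space (k + 1) X
                    ((settingOfRecord₁₃ F N θ.toStage13Params p).lf.alpha0 ((settingOfRecord₁₃ F N θ.toStage13Params p).flow.g (k + 1)))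
                    ((settingOfRecord₁₃ F N θ.toStage13Params p).lf.alpha1 ((settingOfRecord₁₃ F N θ.toStage13Params p).flow.g (k + 1))))) ∧
              (∀ (X : (Sect2.domSys (F.P p.K) θ.τ9.M (k + 1)).Dom) (a : SFluct (F.P p.K) (FluctV N)),
                AnalyticOnNhd ℂ (fun φ => (tnew s).B (k + 1) X φ a)
                  ((sect2TowerOfRecord F N (FluctV N) p.K (settingOfRecord₁₃ F N θ.toStage13Params p) (θ.rzAt p s) s (tnew s)).spaceB (k + 1) X)) ∧
              -- (O3) the 𝐓-image clause for the spliced witness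
              (slotsTOfRecord F N θ.ν θ.τ9 (EOfRecord₁₃ F N θ.toStage13Params) (wOfRecord₉ F N θ.toStage9Params) θ.ppSel p
                  (gOfRecord₁₃ F N θ.toStage13Params p) (k + 1) s = 0 ∨
                ∀ᵐ V' ∂fieldMeasure (F.P p.K) (k + 1) (SU N),
                  chiSeqOfRecord F N θ.ν θ.τ9.M (gOfRecord₁₃ F N θ.toStage13Params p) p.K (k + 1) s V' ≠ 0 →
                    slotsTOfRecord F N θ.ν θ.τ9 (EOfRecord₁₃ F N θ.toStage13Params) (wOfRecord₉ F N θ.toStage9Params) θ.ppSel p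
                        (gOfRecord₁₃ F N θ.toStage13Params p) (k + 1) s V' =
                      sect2Slot F N (FluctV N) p.K (settingOfRecord₁₃ F N θ.toStage13Params p) (θ.rzAt p s) (WtOfRecord₁₃H F N θ p s) s
                        (graftAbove k (t s.init) (tnew s)) (EkN s) (UbgOfRecord₁₃CoP F N θ.toStage13Params p (k + 1) s) V')) :
    Sect3SupplyAt θ p k :=
  sect3SupplyAt_of_spliceSupply_of_guard θ p hE₀ hB₀ (fun s => slotsTOfRecord F N θ.ν θ.τ9 (EOfRecord₁₃ F N θ.toStage13Params) (wOfRecord₉ F N θ.toStage9Params) θ.ppSel p (gOfRecord₁₃ F N θ.toStage13Params p) (k + 1) s ≠ 0) (fun _ hs => not_not.mp hs) h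

end Present

/-! ## §3. Print's indexing: the supply at the labelled large-field decompositions `σ(s₀, t)` -/

section Labels

/-- **★★★ `Sect3SupplyAt θ p k` FROM THE MINIMAL SUPPLY AT THE LABELLED CHILDREN `σ(s₀, t)`** — print's own indexing of §3: for every history `s₀` of length `k` (with the
exposed witness `(t s₀, E_k s₀)` of `ρ_k(s₀)`'s §2 form) and every LABEL `t = (P, Q, R, S)_{k+1}` of the `(k+1)`-st step (NODE 00's `LbOfRecord`; the index map of record
`σOfRecord … k s₀ t` appends the new regions `Ω_{k+1}(t), Λ_{k+1}(t)` of (3.5)∕(3.20)), IF the labelled child expands (`Ω_{k+1}(t) ≠ ∅`) and its 𝐓-slot is present, THEN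
(O1) the old `𝐁^{(k)}` of `t s₀` on the child's `Ũ^c_k(X)` (void at `k = 0`), (O2) r11's new-term obligations + analyticity at `k+1` for `tnew (σ s₀ t)`, (O3) the 𝐓-image
clause at `σ s₀ t` for `graftAbove k (t s₀) (tnew (σ s₀ t)), EkN (σ s₀ t)`.  From §2: a 𝐓-present child is `σ(init s′, t)` for some label (this seat's
`…B14SeparationOfRecord.exists_label_of_slotsTOfRecord_succ_ne_zero`) and `init (σ s₀ t) = s₀`.
[cite: Balaban1988Convergent, Theorem p.245, §3 p.279, (3.1)–(3.5) pp.264–265, (3.16)–(3.20) pp.268–269, (3.24)–(3.25) p.270, Thm 2 p.263] -/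
theorem sect3SupplyAt_of_spliceSupply_at_labels {k : ℕ} (hE₀ : 0 ≤ θ.s2.lf.E₀) (hB₀ : 0 ≤ θ.s2.lf.B₀)
    (h :
        ∀ (t : SeqOfRecord F θ.ν θ.τ9.M (gOfRecord₁₃ F N θ.toStage13Params p) p.K k → Sect2.TermValues (F.P p.K) (MatA N) (FluctV N) θ.τ9.M) (Ek : SeqOfRecord F θ.ν θ.τ9.M (gOfRecord₁₃ F N θ.toStage13Params p) p.K k → ℝ),
          HasSect2FormAtZS F N (FluctV N) p.K (settingOfRecord₁₃ F N θ.toStage13Params p) k (θ.rzAt p) (WtOfRecord₁₃H F N θ p) (UbgOfRecord₁₃CoP F N θ.toStage13Params p k)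
            (fun s u => Sect2.LawsRT (sect2TowerOfRecord F N (FluctV N) p.K (settingOfRecord₁₃ F N θ.toStage13Params p) (θ.rzAt p s) s u) (settingOfRecord₁₃ F N θ.toStage13Params p).lf k)
            (slotsOfRecord F N θ.ν θ.τ9 (EOfRecord₁₃ F N θ.toStage13Params) (wOfRecord₉ F N θ.toStage9Params) θ.ppSel p (gOfRecord₁₃ F N θ.toStage13Params p) k) t Ek →
          ∃ (tnew : SeqOfRecord F θ.ν θ.τ9.M (gOfRecord₁₃ F N θ.toStage13Params p) p.K (k + 1) → Sect2.TermValues (F.P p.K) (MatA N) (FluctV N) θ.τ9.M) (EkN : SeqOfRecord F θ.ν θ.τ9.M (gOfRecord₁₃ F N θ.toStage13Params p) p.K (k + 1) → ℝ),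
            Sect2.UniversalE tnew ∧
            ∀ (s₀ : SeqOfRecord F θ.ν θ.τ9.M (gOfRecord₁₃ F N θ.toStage13Params p) p.K k) (lab : LbOfRecord F θ.ν p (gOfRecord₁₃ F N θ.toStage13Params p) k),
              (σOfRecord F θ.ν θ.τ9.M p (gOfRecord₁₃ F N θ.toStage13Params p) k s₀ lab).Ω (k + 1) ≠ ∅ →
              slotsTOfRecord F N θ.ν θ.τ9 (EOfRecord₁₃ F N θ.toStage13Params) (wOfRecord₉ F N θ.toStage9Params) θ.ppSel p
                  (gOfRecord₁₃ F N θ.toStage13Params p) (k + 1) (σOfRecord F θ.ν θ.τ9.M p (gOfRecord₁₃ F N θ.toStage13Params p) k s₀ lab) ≠ 0 →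
              -- (O1) the old boundary term `𝐁^{(k)}` on the CHILD's space `Ũ^c_k(X)`
              (1 ≤ k →
                (∀ (X : (Sect2.domSys (F.P p.K) θ.τ9.M k).Dom) (φ : Sect2.CPair (F.P p.K) (MatA N)) (a : SFluct (F.P p.K) (FluctV N)),
                  φ ∈ (sect2TowerOfRecord F N (FluctV N) p.K (settingOfRecord₁₃ F N θ.toStage13Params p) (θ.rzAt p (σOfRecord F θ.ν θ.τ9.M p (gOfRecord₁₃ F N θ.toStage13Params p) k s₀ lab)) (σOfRecord F θ.ν θ.τ9.M p (gOfRecord₁₃ F N θ.toStage13Params p) k s₀ lab) (t s₀)).spaceB k X →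
                    ‖(t s₀).B k X φ a‖ ≤ (settingOfRecord₁₃ F N θ.toStage13Params p).lf.B₀ * Real.exp (-(settingOfRecord₁₃ F N θ.toStage13Params p).lf.κ * (Sect2.domSys (F.P p.K) θ.τ9.M k).dj X)) ∧
                (∀ (X : (Sect2.domSys (F.P p.K) θ.τ9.M k).Dom) (a : SFluct (F.P p.K) (FluctV N)),
                  AnalyticOnNhd ℂ (fun φ => (t s₀).B k X φ a)
                    ((sect2TowerOfRecord F N (FluctV N) p.K (settingOfRecord₁₃ F N θ.toStage13Params p) (θ.rzAt p (σOfRecord F θ.ν θ.τ9.M p (gOfRecord₁₃ F N θ.toStage13Params p) k s₀ lab)) (σOfRecord F θ.ν θ.τ9.M p (gOfRecord₁₃ F N θ.toStage13Params p) k s₀ lab) (t s₀)).spaceB k X))) ∧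
              -- (O2) the new terms: r11's new-term obligations and analyticity at `k+1`
              Step.LFNewTerms (sect2TowerOfRecord F N (FluctV N) p.K (settingOfRecord₁₃ F N θ.toStage13Params p) (θ.rzAt p (σOfRecord F θ.ν θ.τ9.M p (gOfRecord₁₃ F N θ.toStage13Params p) k s₀ lab)) (σOfRecord F θ.ν θ.τ9.M p (gOfRecord₁₃ F N θ.toStage13Params p) k s₀ lab) (tnew (σOfRecord F θ.ν θ.τ9.M p (gOfRecord₁₃ F N θ.toStage13Params p) k s₀ lab)))
                (settingOfRecord₁₃ F N θ.toStage13Params p).lf (settingOfRecord₁₃ F N θ.toStage13Params p).βc k ∧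
              (∀ (X : (Sect2.domSys (F.P p.K) θ.τ9.M (k + 1)).Dom) (z : Site (F.P p.K) (k + 1)) (g : ℝ), 0 ≤ g → g ≤ (settingOfRecord₁₃ F N θ.toStage13Params p).lf.γ →
                AnalyticOnNhd ℂ ((tnew (σOfRecord F θ.ν θ.τ9.M p (gOfRecord₁₃ F N θ.toStage13Params p) k s₀ lab)).E (k + 1) X z g)
                  ((sect2TowerOfRecord F N (FluctV N) p.K (settingOfRecord₁₃ F N θ.toStage13Params p) (θ.rzAt p (σOfRecord F θ.ν θ.τ9.M p (gOfRecord₁₃ F N θ.toStage13Params p) k s₀ lab)) (σOfRecord F θ.ν θ.τ9.M p (gOfRecord₁₃ F N θ.toStage13Params p) k s₀ lab) (tnew (σOfRecord F θ.ν θ.τ9.M p (gOfRecord₁₃ F N θ.toStage13Params p) k s₀ lab))).space (k + 1) X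
                    ((settingOfRecord₁₃ F N θ.toStage13Params p).lf.alpha0 ((settingOfRecord₁₃ F N θ.toStage13Params p).flow.g (k + 1)))
                    ((settingOfRecord₁₃ F N θ.toStage13Params p).lf.alpha1 ((settingOfRecord₁₃ F N θ.toStage13Params p).flow.g (k + 1))))) ∧
              (∀ X : (Sect2.domSys (F.P p.K) θ.τ9.M (k + 1)).Dom,
                AnalyticOnNhd ℂ ((tnew (σOfRecord F θ.ν θ.τ9.M p (gOfRecord₁₃ F N θ.toStage13Params p) k s₀ lab)).R (k + 1) X)
                  ((sect2TowerOfRecord F N (FluctV N) p.K (settingOfRecord₁₃ F N θ.toStage13Params p) (θ.rzAt p (σOfRecord F θ.ν θ.τ9.M p (gOfRecord₁₃ F N θ.toStage13Params p) k s₀ lab)) (σOfRecord F θ.ν θ.τ9.M p (gOfRecord₁₃ F N θ.toStage13Params p) k s₀ lab) (tnew (σOfRecord F θ.ν θ.τ9.M p (gOfRecord₁₃ F N θ.toStage13Params p) k s₀ lab))).space (k + 1) X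
                    ((settingOfRecord₁₃ F N θ.toStage13Params p).lf.alpha0 ((settingOfRecord₁₃ F N θ.toStage13Params p).flow.g (k + 1)))
                    ((settingOfRecord₁₃ F N θ.toStage13Params p).lf.alpha1 ((settingOfRecord₁₃ F N θ.toStage13Params p).flow.g (k + 1))))) ∧
              (∀ (X : (Sect2.domSys (F.P p.K) θ.τ9.M (k + 1)).Dom) (a : SFluct (F.P p.K) (FluctV N)),
                AnalyticOnNhd ℂ (fun φ => (tnew (σOfRecord F θ.ν θ.τ9.M p (gOfRecord₁₃ F N θ.toStage13Params p) k s₀ lab)).B (k + 1) X φ a)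
                  ((sect2TowerOfRecord F N (FluctV N) p.K (settingOfRecord₁₃ F N θ.toStage13Params p) (θ.rzAt p (σOfRecord F θ.ν θ.τ9.M p (gOfRecord₁₃ F N θ.toStage13Params p) k s₀ lab)) (σOfRecord F θ.ν θ.τ9.M p (gOfRecord₁₃ F N θ.toStage13Params p) k s₀ lab) (tnew (σOfRecord F θ.ν θ.τ9.M p (gOfRecord₁₃ F N θ.toStage13Params p) k s₀ lab))).spaceB (k + 1) X)) ∧
              -- (O3) the 𝐓-image clause for the spliced witness
              (slotsTOfRecord F N θ.ν θ.τ9 (EOfRecord₁₃ F N θ.toStage13Params) (wOfRecord₉ F N θ.toStage9Params) θ.ppSel p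
                  (gOfRecord₁₃ F N θ.toStage13Params p) (k + 1) (σOfRecord F θ.ν θ.τ9.M p (gOfRecord₁₃ F N θ.toStage13Params p) k s₀ lab) = 0 ∨
                ∀ᵐ V' ∂fieldMeasure (F.P p.K) (k + 1) (SU N),
                  chiSeqOfRecord F N θ.ν θ.τ9.M (gOfRecord₁₃ F N θ.toStage13Params p) p.K (k + 1) (σOfRecord F θ.ν θ.τ9.M p (gOfRecord₁₃ F N θ.toStage13Params p) k s₀ lab) V' ≠ 0 →
                    slotsTOfRecord F N θ.ν θ.τ9 (EOfRecord₁₃ F N θ.toStage13Params) (wOfRecord₉ F N θ.toStage9Params) θ.ppSel p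
                        (gOfRecord₁₃ F N θ.toStage13Params p) (k + 1) (σOfRecord F θ.ν θ.τ9.M p (gOfRecord₁₃ F N θ.toStage13Params p) k s₀ lab) V' =
                      sect2Slot F N (FluctV N) p.K (settingOfRecord₁₃ F N θ.toStage13Params p) (θ.rzAt p (σOfRecord F θ.ν θ.τ9.M p (gOfRecord₁₃ F N θ.toStage13Params p) k s₀ lab)) (WtOfRecord₁₃H F N θ p (σOfRecord F θ.ν θ.τ9.M p (gOfRecord₁₃ F N θ.toStage13Params p) k s₀ lab)) (σOfRecord F θ.ν θ.τ9.M p (gOfRecord₁₃ F N θ.toStage13Params p) k s₀ lab)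
                        (graftAbove k (t s₀) (tnew (σOfRecord F θ.ν θ.τ9.M p (gOfRecord₁₃ F N θ.toStage13Params p) k s₀ lab))) (EkN (σOfRecord F θ.ν θ.τ9.M p (gOfRecord₁₃ F N θ.toStage13Params p) k s₀ lab)) (UbgOfRecord₁₃CoP F N θ.toStage13Params p (k + 1) (σOfRecord F θ.ν θ.τ9.M p (gOfRecord₁₃ F N θ.toStage13Params p) k s₀ lab)) V')) :
    Sect3SupplyAt θ p k := by
  refine sect3SupplyAt_of_spliceSupply_at_present_children θ p hE₀ hB₀ fun t Ek hS => ?_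
  obtain ⟨tnew, EkN, huN, hx⟩ := h t Ek hS
  refine ⟨tnew, EkN, huN, fun s hsΩ hsT => ?_⟩
  obtain ⟨lab, hlab⟩ := exists_label_of_slotsTOfRecord_succ_ne_zero F N θ.ν θ.τ9 (EOfRecord₁₃ F N θ.toStage13Params) θ.ppSel p (gOfRecord₁₃ F N θ.toStage13Params p) k
    θ.A₁ θ.ζ s hsT
  have H := hx s.init lab
  rw [hlab] at H
  exact H hsΩ hsT

end Labels

/-! ## §4. A6: the minimal supply where no expansion child has a present parent -/

section A6

/-- **A6 — `Sect3SpliceSupplyAt θ p k` IS INHABITED AT A LEVEL WHERE NO EXPANSION CHILD HAS A PRESENT PARENT** (e.g. every present parent is an all-large history, whose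
children cannot expand: `Ω_{k+1} ⊆ Ω_k = ∅`): take `tnew := 0`, `EkN := 0`; the obligations are void.  So the predicate's entire content sits at the expansion children of
present parents — [III] §3 proper. [cite: Balaban1988Convergent, §2 p.262, (3.25) p.270, (2.1) p.254 (bookkeeping)] -/
theorem sect3SpliceSupplyAt_of_forall_not_present (k : ℕ)
    (hno : ∀ s : SeqOfRecord F θ.ν θ.τ9.M (gOfRecord₁₃ F N θ.toStage13Params p) p.K (k + 1), s.Ω (k + 1) ≠ ∅ → slotsOfRecord F N θ.ν θ.τ9 (EOfRecord₁₃ F N θ.toStage13Params) (wOfRecord₉ F N θ.toStage9Params) θ.ppSel p (gOfRecord₁₃ F N θ.toStage13Params p) k s.init = 0) :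
    Sect3SpliceSupplyAt θ p k := fun _ _ _ =>
  ⟨fun _ => Sect2.TermValues.zero, fun _ => 0, Sect2.universalE_const _, fun s hsΩ hne => absurd (hno s hsΩ) hne⟩

end A6

end Summit.QuantumFields.YangMills.Theorems.BalabanUVNodesN11Sect3SupplySpliceLabels

end
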